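import Summits.Ventures.YMGap.RobustBall.PeriodisedBox
import Summits.Ventures.YMGap.RobustBall.LatticeSumL1
import Summits.Ventures.YMGap.RobustBall.OneStateInvariant
import Summits.Ventures.YMGap.Thresholds.LinearResponseBound
import Summits.Ventures.YMGap.Thresholds.CouplingDerivative
import Summits.Ventures.YMGap.RobustBall.UniformLoopCorrelatorDecay
import HarnessLib

/-!
# Venture YMGap, track ROBUST-BALL — FLUCTUATION–RESPONSE: the cross-covariance density of two block observables converges to the
# cross-susceptibility, and for `SU(2)` on `ℤ⁴` the response `d⟨F⟩/dβ_W` IS the covariance density of `F` against the energy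

HONEST FRAMING. WHAT THIS IS: a venture file (cell `pub-ymgap`, track Y2 ROBUST-BALL, seat ds-3, theorems only): the BILINEAR companion
of this seat's `ThermodynamicVariance.lean` (C-TVAR, which is the case `f = g`) joined with ds-1's C-DIFF linear-response identity
`d/dβ_W ⟨F⟩_{β_W} = Σ_q Cov_{β_W}(F, W_q)` (`CouplingResponse.su2_hasDerivAt_integral_9_25`). For ANY translation-invariant probability measure
`μ` on the `ℤ^d` link configurations and bounded measurable `f, g` with absolutely summable cross-covariance `c(v) = cov_μ(f, g∘θ_v)`:

* `covariance_boxSum_boxSum_eq` — `Cov_μ(Σ_{x∈B} f∘θ_x, Σ_{y∈B} g∘θ_y) = Σ_{x,y∈B} c(y − x)`;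
* ★ `abs_covariance_boxSum_sub_le`, `abs_covariance_boxSum_div_sub_le` — `|Cov_μ(S_n f, S_n g)/#B_n − Σ_v c(v)| ≤ Σ_{v∉B_k}|c(v)| + (2dk/(2n+1))Σ_v|c(v)|`;
* ★★ `tendsto_covariance_boxSum_div` — `Cov_μ(Σ_{x∈B_n} f∘θ_x, Σ_{x∈B_n} g∘θ_x)/#B_n → χ(f,g) := Σ_{v∈ℤ^d} cov_μ(f, g∘θ_v)`;
* `tsum_covariance_energy_shift_eq'` — against the plaquette energy density `e = Σ_{i<j} W_{(0;i,j)}` the cross-susceptibility of a bounded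
  observable `F` is ds-1's static response `Σ_q cov_μ(F, W_q)` (all plaquettes `q` of `ℤ^d`);
* ★★★ CELL `su2_response_eq_lim_covariance_density` — `SU(2)` on `ℤ⁴`, `0 < β_W < 9/25`, ANY DLR selection `μ(·)` (the state is unique):
  for every Lipschitz cylinder observable `F` with `|F| ≤ 1`:
  `Cov_{μ β_W}(Σ_{x∈B_n} F∘θ_x, Σ_{x∈B_n} e∘θ_x)/#B_n → d/dβ_W ⟨F⟩_{β_W}` — the FLUCTUATION–RESPONSE THEOREM in infinite volume: the
  β_W-response of every local observable is its thermodynamic covariance density against the energy.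
WHAT THIS IS NOT: not a CLT, no statement outside the vertex-star window for the cell, lattice only; nothing about the continuum or Clay.
References: B. Simon, *The Statistical Mechanics of Lattice Gases* I (1993), §II.12; tree `ThermodynamicVariance`, `CouplingDerivative`.
-/
noncomputable section
open MeasureTheory Filter Function ProbabilityTheory Real Topology Set
open scoped NNReal
open Literature.Probability.LatticeModels hiding configShift configShift_apply
open Literature.MathematicalPhysics.QuantumLattice
open Literature.MathematicalPhysics.QuantumFieldTheory hiding ZdEdge Site IsLocalObservable
open Literature.MathematicalPhysics.QuantumFieldTheory (walkEdges)
open SimpleGraph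
open Literature.Probability.LatticeModels.DobrushinMetric (integrable_of_abs_le')

namespace Summit.Ventures.YMGap.RobustBall
namespace ResponseFluctuation
variable {d : ℕ} {G : Type*} [MeasurableSpace G]

/-- **Cross-covariance of two block sums as a double sum**: for a translation-invariant probability measure and bounded measurable
`f, g`, `Cov_μ(Σ_{x∈B} f∘θ_x, Σ_{y∈B} g∘θ_y) = Σ_{x∈B} Σ_{y∈B} cov_μ(f, g∘θ_{y−x})` for every finite `B`. [folklore] -/
theorem covariance_boxSum_boxSum_eq {μ : Measure (LGConfig d G)} [IsProbabilityMeasure μ] (hμ : IsZdTranslationInvariant μ)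
    {f g : LGConfig d G → ℝ} (hfm : Measurable f) {Mf : ℝ} (hfb : ∀ U, |f U| ≤ Mf) (hgm : Measurable g) {Mg : ℝ}
    (hgb : ∀ U, |g U| ≤ Mg) (B : Finset (Site d)) :
    cov[fun U => ∑ x ∈ B, f (configShift x U), fun U => ∑ y ∈ B, g (configShift y U); μ] =
      ∑ x ∈ B, ∑ y ∈ B, cov[f, fun U => g (configShift (y - x) U); μ] := by
  set Fx : Site d → LGConfig d G → ℝ := fun x U => f (configShift x U) with hFx
  set Gy : Site d → LGConfig d G → ℝ := fun y U => g (configShift y U) with hGy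
  have hmemf : ∀ x : Site d, MemLp (Fx x) 2 μ := fun x =>
    memLp_of_bounded (a := -Mf) (b := Mf) (ae_of_all _ fun U => by simp only [Set.mem_Icc]; exact abs_le.1 (hfb _))
      (hfm.comp (configShift x).measurable).aestronglyMeasurable 2
  have hmemg : ∀ y : Site d, MemLp (Gy y) 2 μ := fun y =>
    memLp_of_bounded (a := -Mg) (b := Mg) (ae_of_all _ fun U => by simp only [Set.mem_Icc]; exact abs_le.1 (hgb _))
      (hgm.comp (configShift y).measurable).aestronglyMeasurable 2
  -- translation invariance: `cov(f∘θ_x, g∘θ_y) = cov(f, g∘θ_{y−x})` (the tree's shift composition law inlined)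
  have hshift : ∀ x y : Site d, cov[Fx x, Gy y; μ] = cov[f, fun U => g (configShift (y - x) U); μ] := by
    intro x y
    have hcomp : Gy y = fun U => g (configShift (y - x) (configShift x U)) := by
      funext U
      simp only [hGy]
      congr 1
      funext e
      simp only [configShift_apply]
      congr 1
      ext <;> simp [sub_sub]
    rw [hcomp]
    have h := covariance_map_equiv (μ := μ) f (fun U => g (configShift (y - x) U)) (configShift x)
    rw [hμ x] at h
    exact h.symm
  have hsf : (fun U => ∑ x ∈ B, f (configShift x U)) = ∑ x ∈ B, Fx x := by funext U; simp [hFx]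
  have hsg : (fun U => ∑ y ∈ B, g (configShift y U)) = ∑ y ∈ B, Gy y := by funext U; simp [hGy]
  rw [hsf, hsg, covariance_sum_sum' (fun x _ => hmemf x) (fun y _ => hmemg y)]
  exact Finset.sum_congr rfl fun x _ => Finset.sum_congr rfl fun y _ => hshift x y

/-- ★ **THE CROSS-COVARIANCE OF BLOCK SUMS, QUANTITATIVE FORM**: for a translation-invariant probability measure, bounded measurable `f, g`
with absolutely summable cross-covariance `c(v) = cov_μ(f, g∘θ_v)` and all `k ≤ n`:
`|Cov_μ(S_n f, S_n g) − #B_n Σ_v c(v)| ≤ #B_n Σ_{v∉B_k}|c(v)| + (#B_n − #B_{n−k}) Σ_v|c(v)|`, `S_n h = Σ_{x∈B_n} h∘θ_x`. [folklore] -/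
theorem abs_covariance_boxSum_sub_le {μ : Measure (LGConfig d G)} [IsProbabilityMeasure μ] (hμ : IsZdTranslationInvariant μ)
    {f g : LGConfig d G → ℝ} (hfm : Measurable f) {Mf : ℝ} (hfb : ∀ U, |f U| ≤ Mf) (hgm : Measurable g) {Mg : ℝ}
    (hgb : ∀ U, |g U| ≤ Mg) (hsum : Summable fun v : Site d => |cov[f, fun U => g (configShift v U); μ]|)
    {n k : ℕ} (hk : k ≤ n) :
    |cov[fun U => ∑ x ∈ siteBox d n, f (configShift x U), fun U => ∑ x ∈ siteBox d n, g (configShift x U); μ] -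
        (siteBox d n).card * ∑' v, cov[f, fun U => g (configShift v U); μ]| ≤
      (siteBox d n).card * (∑' v : {v : Site d // v ∉ siteBox d k}, |cov[f, fun U => g (configShift v U); μ]|) +
        ((siteBox d n).card - (siteBox d (n - k)).card : ℝ) * ∑' v, |cov[f, fun U => g (configShift v U); μ]| := by
  classical
  set c : Site d → ℝ := fun v => cov[f, fun U => g (configShift v U); μ] with hc
  have hsc : Summable c := hsum.of_abs
  set tail : ℝ := ∑' v : {v : Site d // v ∉ siteBox d k}, |c v| with htail
  set A : ℝ := ∑' v, |c v| with hA
  have htail0 : 0 ≤ tail := tsum_nonneg fun _ => abs_nonneg _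
  rw [covariance_boxSum_boxSum_eq hμ hfm hfb hgm hgb]
  have hrow : ∀ x ∈ siteBox d n, |∑ y ∈ siteBox d n, c (y - x) - ∑' v, c v| ≤
      if x ∈ siteBox d (n - k) then tail else A := by
    intro x hx
    set T : Finset (Site d) := (siteBox d n).image (fun y => y - x) with hT
    have hinj : Set.InjOn (fun y : Site d => y - x) ↑(siteBox d n) := fun a _ b _ h => sub_left_injective h
    have h1 : ∑ y ∈ siteBox d n, c (y - x) = ∑ v ∈ T, c v := by rw [Finset.sum_image hinj]
    have h2 : ∑ v ∈ T, c v + ∑' v : {v // v ∉ T}, c v = ∑' v, c v := hsc.sum_add_tsum_compl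
    have h3 : ∑ y ∈ siteBox d n, c (y - x) - ∑' v, c v = -∑' v : {v // v ∉ T}, c v := by rw [h1, ← h2]; ring
    rw [h3, abs_neg]
    have hsT : Summable fun v : {v // v ∉ T} => |c v| := hsum.subtype _
    have h4 : |∑' v : {v // v ∉ T}, c v| ≤ ∑' v : {v // v ∉ T}, |c v| := by
      have h := norm_tsum_le_tsum_norm (f := fun v : {v // v ∉ T} => c v) (by simpa [Real.norm_eq_abs] using hsT)
      simpa [Real.norm_eq_abs] using h
    refine h4.trans ?_
    split_ifs with hxin
    · have hsub : ∀ v : Site d, v ∉ T → v ∉ siteBox d k := by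
        intro v hvT hvk
        refine hvT (Finset.mem_image.2 ⟨v + x, ?_, by simp⟩)
        rw [mem_siteBox_iff_norm] at hvk hxin ⊢
        calc ‖v + x‖ ≤ ‖v‖ + ‖x‖ := norm_add_le _ _
          _ ≤ k + ((n - k : ℕ) : ℝ) := add_le_add hvk hxin
          _ = n := by rw [Nat.cast_sub hk]; ring
      exact Summable.tsum_le_tsum_of_inj (f := fun v : {v // v ∉ T} => |c v|)
        (g := fun v : {v : Site d // v ∉ siteBox d k} => |c v|)
        (fun v => ⟨v.1, hsub v.1 v.2⟩) (fun a b h => Subtype.ext (by simpa using congrArg Subtype.val h))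
        (fun _ _ => abs_nonneg _) (fun _ => le_rfl) hsT (hsum.subtype _)
    · exact Summable.tsum_subtype_le (fun v => |c v|) {v | v ∉ T} (fun _ => abs_nonneg _) hsum
  have hsubB : siteBox d (n - k) ⊆ siteBox d n := fun x hx => by
    rw [mem_siteBox_iff_norm] at hx ⊢
    exact hx.trans (by exact_mod_cast Nat.sub_le n k)
  have hcard : ((siteBox d (n - k)).card : ℝ) ≤ (siteBox d n).card := by exact_mod_cast Finset.card_le_card hsubB
  calc |∑ x ∈ siteBox d n, ∑ y ∈ siteBox d n, c (y - x) - (siteBox d n).card * ∑' v, c v|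
      = |∑ x ∈ siteBox d n, (∑ y ∈ siteBox d n, c (y - x) - ∑' v, c v)| := by
        rw [Finset.sum_sub_distrib, Finset.sum_const, nsmul_eq_mul]
    _ ≤ ∑ x ∈ siteBox d n, |∑ y ∈ siteBox d n, c (y - x) - ∑' v, c v| := Finset.abs_sum_le_sum_abs _ _
    _ ≤ ∑ x ∈ siteBox d n, (if x ∈ siteBox d (n - k) then tail else A) := Finset.sum_le_sum hrow
    _ = (siteBox d (n - k)).card * tail + ((siteBox d n).card - (siteBox d (n - k)).card : ℝ) * A := by
        rw [Finset.sum_ite, Finset.sum_const, Finset.sum_const, nsmul_eq_mul, nsmul_eq_mul,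
          Finset.filter_mem_eq_inter, Finset.inter_eq_right.2 hsubB, Finset.filter_not, Finset.filter_mem_eq_inter,
          Finset.inter_eq_right.2 hsubB, Finset.card_sdiff_of_subset hsubB, Nat.cast_sub (Finset.card_le_card hsubB)]
    _ ≤ (siteBox d n).card * tail + ((siteBox d n).card - (siteBox d (n - k)).card : ℝ) * A := by
        gcongr

/-- ★ **RATE FORM**: under the same hypotheses, for all `k ≤ n`:
`|Cov_μ(S_n f, S_n g)/#B_n − Σ_v c(v)| ≤ Σ_{v∉B_k}|c(v)| + (2dk/(2n+1)) Σ_v|c(v)|`. [folklore] -/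
theorem abs_covariance_boxSum_div_sub_le {μ : Measure (LGConfig d G)} [IsProbabilityMeasure μ]
    (hμ : IsZdTranslationInvariant μ) {f g : LGConfig d G → ℝ} (hfm : Measurable f) {Mf : ℝ} (hfb : ∀ U, |f U| ≤ Mf)
    (hgm : Measurable g) {Mg : ℝ} (hgb : ∀ U, |g U| ≤ Mg)
    (hsum : Summable fun v : Site d => |cov[f, fun U => g (configShift v U); μ]|) {n k : ℕ} (hk : k ≤ n) :
    |cov[fun U => ∑ x ∈ siteBox d n, f (configShift x U), fun U => ∑ x ∈ siteBox d n, g (configShift x U); μ] /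
          (siteBox d n).card - ∑' v, cov[f, fun U => g (configShift v U); μ]| ≤
      (∑' v : {v : Site d // v ∉ siteBox d k}, |cov[f, fun U => g (configShift v U); μ]|) +
        2 * (d : ℝ) * k / (2 * n + 1) * ∑' v, |cov[f, fun U => g (configShift v U); μ]| := by
  have hn : (0 : ℝ) < 2 * n + 1 := by positivity
  -- `#B_m = (2m+1)^d` (the tree's `ThermodynamicVariance.card_siteBox`, inlined in real-cast form)
  have hcardB : ∀ m : ℕ, ((siteBox d m).card : ℝ) = (2 * (m : ℝ) + 1) ^ d := by
    intro m
    have h : (siteBox d m).card = (2 * m + 1) ^ d := by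
      rw [siteBox, Fintype.card_piFinset]
      simp only [Int.card_Icc, Finset.prod_const, Finset.card_univ, Fintype.card_fin]
      congr 1
      have h : ((m : ℤ) + 1 - -(m : ℤ)) = ((2 * m + 1 : ℕ) : ℤ) := by push_cast; ring
      rw [h, Int.toNat_natCast]
    rw [h]; push_cast; ring
  have hB : (0 : ℝ) < (siteBox d n).card := by rw [hcardB]; positivity
  have key := abs_covariance_boxSum_sub_le hμ hfm hfb hgm hgb hsum hk
  have hA0 : 0 ≤ ∑' v, |cov[f, fun U => g (configShift v U); μ]| := tsum_nonneg fun _ => abs_nonneg _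
  -- Bernoulli: `1 − #B_{n−k}/#B_n ≤ 2dk/(2n+1)`
  have hratio : ((siteBox d n).card - (siteBox d (n - k)).card : ℝ) ≤ 2 * (d : ℝ) * k / (2 * n + 1) * (siteBox d n).card := by
    rw [hcardB, hcardB]
    set a : ℝ := -(2 * (k : ℝ) / (2 * n + 1)) with ha
    have h1 : (2 * ((n - k : ℕ) : ℝ) + 1) = (1 + a) * (2 * n + 1) := by
      rw [Nat.cast_sub hk, ha]; field_simp; ring
    have hkn : (k : ℝ) ≤ n := by exact_mod_cast hk
    have hk' : (2 * (k : ℝ)) / (2 * n + 1) ≤ 1 := by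
      rw [div_le_one hn]; linarith
    have hB := one_add_mul_le_pow (a := a) (by rw [ha]; linarith [show (0:ℝ) ≤ 2 * k / (2 * n + 1) by positivity]) d
    have e : (d : ℝ) * a = -(2 * (d : ℝ) * k / (2 * n + 1)) := by rw [ha]; ring
    rw [h1, mul_pow]
    have hp : (0 : ℝ) < (2 * (n : ℝ) + 1) ^ d := by positivity
    nlinarith [hB, hp]
  have e : cov[fun U => ∑ x ∈ siteBox d n, f (configShift x U), fun U => ∑ x ∈ siteBox d n, g (configShift x U); μ] /
        (siteBox d n).card - ∑' v, cov[f, fun U => g (configShift v U); μ] =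
      (cov[fun U => ∑ x ∈ siteBox d n, f (configShift x U), fun U => ∑ x ∈ siteBox d n, g (configShift x U); μ] -
        (siteBox d n).card * ∑' v, cov[f, fun U => g (configShift v U); μ]) / (siteBox d n).card := by
    field_simp
  rw [e, abs_div, abs_of_pos hB, div_le_iff₀ hB]
  refine key.trans ?_
  calc (siteBox d n).card * (∑' v : {v : Site d // v ∉ siteBox d k}, |cov[f, fun U => g (configShift v U); μ]|) +
        ((siteBox d n).card - (siteBox d (n - k)).card : ℝ) * ∑' v, |cov[f, fun U => g (configShift v U); μ]|
      ≤ (siteBox d n).card * (∑' v : {v : Site d // v ∉ siteBox d k}, |cov[f, fun U => g (configShift v U); μ]|) +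
        (2 * (d : ℝ) * k / (2 * n + 1) * (siteBox d n).card) * ∑' v, |cov[f, fun U => g (configShift v U); μ]| := by
        gcongr
    _ = ((∑' v : {v : Site d // v ∉ siteBox d k}, |cov[f, fun U => g (configShift v U); μ]|) +
        2 * (d : ℝ) * k / (2 * n + 1) * ∑' v, |cov[f, fun U => g (configShift v U); μ]|) * (siteBox d n).card := by ring

/-- ★★ **THE CROSS-COVARIANCE DENSITY IS THE CROSS-SUSCEPTIBILITY**: for a translation-invariant probability measure and bounded
measurable `f, g` with absolutely summable cross-covariance: `Cov_μ(Σ_{x∈B_n} f∘θ_x, Σ_{x∈B_n} g∘θ_x)/#B_n → Σ_{v∈ℤ^d} cov_μ(f, g∘θ_v)`.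
[folklore] -/
theorem tendsto_covariance_boxSum_div {μ : Measure (LGConfig d G)} [IsProbabilityMeasure μ]
    (hμ : IsZdTranslationInvariant μ) {f g : LGConfig d G → ℝ} (hfm : Measurable f) {Mf : ℝ} (hfb : ∀ U, |f U| ≤ Mf)
    (hgm : Measurable g) {Mg : ℝ} (hgb : ∀ U, |g U| ≤ Mg)
    (hsum : Summable fun v : Site d => |cov[f, fun U => g (configShift v U); μ]|) :
    Tendsto (fun n : ℕ => cov[fun U => ∑ x ∈ siteBox d n, f (configShift x U),
        fun U => ∑ x ∈ siteBox d n, g (configShift x U); μ] / (siteBox d n).card) atTop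
      (𝓝 (∑' v, cov[f, fun U => g (configShift v U); μ])) := by
  classical
  set c : Site d → ℝ := fun v => cov[f, fun U => g (configShift v U); μ] with hc
  set A : ℝ := ∑' v, |c v| with hA
  have hA0 : 0 ≤ A := tsum_nonneg fun _ => abs_nonneg _
  rw [Metric.tendsto_atTop]
  intro ε hε
  have htails := tendsto_tsum_compl_atTop_zero (fun v : Site d => |c v|)
  obtain ⟨s₀, hs₀⟩ := Metric.tendsto_atTop.1 htails (ε / 2) (half_pos hε)
  obtain ⟨L, hL⟩ := (eventually_subset_siteBox (d := d) s₀).exists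
  set k₀ : ℕ := L / 2 with hk₀
  have htail : ∑' v : {v : Site d // v ∉ siteBox d k₀}, |c v| < ε / 2 := by
    have h := hs₀ (siteBox d k₀) hL
    rw [Real.dist_eq, sub_zero, abs_of_nonneg (tsum_nonneg fun _ => abs_nonneg _)] at h
    exact h
  obtain ⟨N₁, hN₁⟩ := Metric.tendsto_atTop.1 (tendsto_const_div_atTop_nhds_zero_nat (2 * (d : ℝ) * k₀ * A)) (ε / 2)
    (half_pos hε)
  refine ⟨max k₀ (max N₁ 1), fun n hn => ?_⟩
  have hnk : k₀ ≤ n := le_trans (le_max_left _ _) hn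
  have hnN : N₁ ≤ n := le_trans ((le_max_left _ _).trans (le_max_right _ _)) hn
  have hn1 : 1 ≤ n := le_trans ((le_max_right _ _).trans (le_max_right _ _)) hn
  have hsurf : 2 * (d : ℝ) * k₀ / (2 * n + 1) * A < ε / 2 := by
    have h := hN₁ n hnN
    rw [Real.dist_eq, sub_zero, abs_of_nonneg (by positivity)] at h
    have hnpos : (0 : ℝ) < n := by exact_mod_cast hn1
    calc 2 * (d : ℝ) * k₀ / (2 * n + 1) * A = (2 * (d : ℝ) * k₀ * A) / (2 * n + 1) := by ring
      _ ≤ (2 * (d : ℝ) * k₀ * A) / n := div_le_div_of_nonneg_left (by positivity) hnpos (by linarith)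
      _ < ε / 2 := h
  rw [Real.dist_eq]
  calc |cov[fun U => ∑ x ∈ siteBox d n, f (configShift x U), fun U => ∑ x ∈ siteBox d n, g (configShift x U); μ] /
          (siteBox d n).card - ∑' v, c v|
      ≤ (∑' v : {v : Site d // v ∉ siteBox d k₀}, |c v|) + 2 * (d : ℝ) * k₀ / (2 * n + 1) * A :=
        abs_covariance_boxSum_div_sub_le hμ hfm hfb hgm hgb hsum hnk
    _ < ε / 2 + ε / 2 := add_lt_add htail hsurf
    _ = ε := by ring

/-- `W_{(0;i,j)}(θ_v U) = W_{(−v;i,j)}(U)`: a translated configuration read on the plaquette at the origin is the configuration read on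
the plaquette at `−v` (the base-point-`0` instance of the general shift law). [folklore] -/
theorem zdPlaquetteObs_zero_comp_configShift {N : ℕ} {H : Type*} [Group H] [MeasurableSpace H] {ρ : H →* Matrix (Fin N) (Fin N) ℂ}
    (v : Site d) (i j : Fin d) (U : LGConfig d H) :
    zdPlaquetteObs ρ 0 i j (configShift v U) = zdPlaquetteObs ρ (-v) i j U := by
  have h : zdPlaquetteObs ρ 0 i j (configShift v U) = zdPlaquetteObs ρ (0 - v) i j U := by
    simp only [zdPlaquetteObs, ZdGaugeConfig.plaquette, configShift_apply, add_sub_right_comm]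
  rw [h, zero_sub]

/-- **Rearrangement**: for a probability measure `ν` on the `SU(N)` link configurations of `ℤ^d`, a bounded measurable `F` whose
covariances against all plaquettes are absolutely summable (`Σ_r |cov_ν(F, W_r)| < ∞`), and the energy density
`e = Σ_{i<j} W_{(0;i,j)}`: the cross-covariance `v ↦ cov_ν(F, e∘θ_v)` is absolutely summable over `ℤ^d` and
`Σ_v cov_ν(F, e∘θ_v) = Σ_r cov_ν(F, W_r)` (all plaquettes `r`). [folklore] -/
theorem tsum_covariance_energy_shift_eq' {N : ℕ} {ν : Measure (LGConfig d (Matrix.specialUnitaryGroup (Fin N) ℂ))}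
    [IsProbabilityMeasure ν] {F : LGConfig d (Matrix.specialUnitaryGroup (Fin N) ℂ) → ℝ} (hFm : Measurable F) {MF : ℝ}
    (hFb : ∀ U, |F U| ≤ MF)
    (hsum : Summable fun r : ZdPlaquette d =>
      |cov[F, zdPlaquetteObs (fundamentalRep (Fin N)) r.1 r.2.1.1 r.2.1.2; ν]|) :
    (Summable fun v : Site d => |cov[F, fun U => ∑ q : {q : Fin d × Fin d // q.1 < q.2},
        zdPlaquetteObs (fundamentalRep (Fin N)) 0 q.1.1 q.1.2 (configShift v U); ν]|) ∧
    ∑' v : Site d, cov[F, fun U => ∑ q : {q : Fin d × Fin d // q.1 < q.2},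
        zdPlaquetteObs (fundamentalRep (Fin N)) 0 q.1.1 q.1.2 (configShift v U); ν] =
      ∑' r : ZdPlaquette d, cov[F, zdPlaquetteObs (fundamentalRep (Fin N)) r.1 r.2.1.1 r.2.1.2; ν] := by
  classical
  set W : ZdPlaquette d → LGConfig d (Matrix.specialUnitaryGroup (Fin N) ℂ) → ℝ :=
    fun r => zdPlaquetteObs (fundamentalRep (Fin N)) r.1 r.2.1.1 r.2.1.2 with hW
  set g : ZdPlaquette d → ℝ := fun r => cov[F, W r; ν] with hg
  have hFmem : MemLp F 2 ν :=
    memLp_of_bounded (a := -MF) (b := MF) (ae_of_all _ fun U => by simp only [Set.mem_Icc]; exact abs_le.1 (hFb U))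
      hFm.aestronglyMeasurable 2
  have hmem : ∀ r : ZdPlaquette d, MemLp (W r) 2 ν := fun r =>
    memLp_of_bounded (a := -1) (b := 1)
      (ae_of_all _ fun U => by
        have h1 := abs_zdPlaquetteObs_le fundamentalRep_mem_unitaryGroup r.1 r.2.1.1 r.2.1.2 U
        simp only [Set.mem_Icc]; exact abs_le.1 h1)
      (isLipschitzCylinder_zdPlaquetteObs r.1 r.2.2).measurable.aestronglyMeasurable 2
  have hcov : ∀ v : Site d, cov[F, fun U => ∑ q : {q : Fin d × Fin d // q.1 < q.2}, W (0, q) (configShift v U); ν] =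
      ∑ q' : {q : Fin d × Fin d // q.1 < q.2}, g (-v, q') := by
    intro v
    have hshift : (fun U => ∑ q : {q : Fin d × Fin d // q.1 < q.2}, W (0, q) (configShift v U)) =
        ∑ q : {q : Fin d × Fin d // q.1 < q.2}, W (-v, q) := by
      funext U
      simp only [hW, Finset.sum_apply, zdPlaquetteObs_zero_comp_configShift]
    rw [hshift, covariance_sum_right (fun q' => hmem (-v, q')) hFmem]
  have hrow : ∀ q' : {q : Fin d × Fin d // q.1 < q.2}, Summable fun v : Site d => |g (-v, q')| := by
    intro q'
    have h1 : Summable fun v : Site d => |g (v, q')| :=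
      hsum.comp_injective (f := fun r : ZdPlaquette d => |g r|)
        (show Function.Injective (fun v : Site d => ((v, q') : ZdPlaquette d)) from fun a b h => (Prod.mk.inj h).1)
    exact (Equiv.neg (Site d)).summable_iff.2 h1
  have hcol : ∀ q' : {q : Fin d × Fin d // q.1 < q.2}, Summable fun v : Site d => g (v, q') := fun q' =>
    (hsum.of_abs).comp_injective
      (show Function.Injective (fun v : Site d => ((v, q') : ZdPlaquette d)) from fun a b h => (Prod.mk.inj h).1)
  have hS : Summable fun v : Site d =>
      |cov[F, fun U => ∑ q : {q : Fin d × Fin d // q.1 < q.2}, W (0, q) (configShift v U); ν]| := by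
    refine Summable.of_nonneg_of_le (fun v => abs_nonneg _) (fun v => ?_)
      (summable_sum (s := (Finset.univ : Finset {q : Fin d × Fin d // q.1 < q.2}))
        (f := fun q' v => |g (-v, q')|) fun q' _ => hrow q')
    rw [hcov v]; exact Finset.abs_sum_le_sum_abs _ _
  refine ⟨hS, ?_⟩
  have hneg : ∀ q' : {q : Fin d × Fin d // q.1 < q.2}, ∑' v : Site d, g (-v, q') = ∑' v : Site d, g (v, q') :=
    fun q' => (Equiv.neg (Site d)).tsum_eq (fun v => g (v, q'))
  calc ∑' v : Site d, cov[F, fun U => ∑ q : {q : Fin d × Fin d // q.1 < q.2}, W (0, q) (configShift v U); ν]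
      = ∑' v : Site d, ∑ q' : {q : Fin d × Fin d // q.1 < q.2}, g (-v, q') := tsum_congr fun v => hcov v
    _ = ∑ q' : {q : Fin d × Fin d // q.1 < q.2}, ∑' v : Site d, g (-v, q') :=
        Summable.tsum_finsetSum fun q' _ => (hrow q').of_abs
    _ = ∑ q' : {q : Fin d × Fin d // q.1 < q.2}, ∑' v : Site d, g (v, q') := by simp_rw [hneg]
    _ = ∑' v : Site d, ∑ q' : {q : Fin d × Fin d // q.1 < q.2}, g (v, q') :=
        (Summable.tsum_finsetSum fun q' _ => hcol q').symm
    _ = ∑' v : Site d, ∑' q' : {q : Fin d × Fin d // q.1 < q.2}, g (v, q') := by simp_rw [tsum_fintype]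
    _ = ∑' r : ZdPlaquette d, g r := (hsum.of_abs.tsum_prod).symm

/-- ★★★ **FLUCTUATION–RESPONSE THEOREM** (`SU(2)`, `ℤ⁴`, `0 < β_W < 9/25`): for ANY DLR selection `μ(·)` (`μ β_W` a DLR state at tree
coupling `β_W/2` for every `β_W`; the state is unique in the window, translation invariant and massive) and every Lipschitz cylinder
observable `F` with `|F| ≤ 1` (constant `K`, nonempty link set `Λ`):
`Cov_{μ β_W}(Σ_{x∈B_n} F∘θ_x, Σ_{x∈B_n} e∘θ_x)/#B_n → d/dβ_W ⟨F⟩_{β_W}` with `e = Σ_{i<j} W_{(0;i,j)}` the plaquette energy density —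
the β_W-RESPONSE of every local observable (ds-1's C-DIFF `su2_hasDerivAt_integral_9_25`) IS its thermodynamic covariance density against
the energy (`tendsto_covariance_boxSum_div` + `tsum_covariance_energy_shift_eq'` + ds-1's `su2_summable_abs_cov_cylinder_plaquette`).
[folklore] -/
theorem su2_response_eq_lim_covariance_density
    {μ : ℝ → Measure (LGConfig 4 (Matrix.specialUnitaryGroup (Fin 2) ℂ))}
    (hμ : ∀ βW : ℝ, μ βW ∈ ymGibbsMeasures (d := 4) (fundamentalRep (Fin 2)) (2 * (βW / 4)))
    {F : LGConfig 4 (Matrix.specialUnitaryGroup (Fin 2) ℂ) → ℝ} {Λ : Finset (ZdEdge 4)} {K : ℝ≥0}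
    (hF : IsLipschitzCylinder (fundamentalRep (Fin 2)) F Λ K) (hΛ : Λ.Nonempty) (hF1 : ∀ U, |F U| ≤ 1)
    {βW : ℝ} (hb : βW ∈ Ioo (0 : ℝ) (9 / 25)) :
    Tendsto (fun n : ℕ => cov[fun U => ∑ x ∈ siteBox 4 n, F (configShift x U),
        fun U => ∑ x ∈ siteBox 4 n, ∑ q : {q : Fin 4 × Fin 4 // q.1 < q.2},
          zdPlaquetteObs (fundamentalRep (Fin 2)) 0 q.1.1 q.1.2 (configShift x U); μ βW] / (siteBox 4 n).card) atTop
      (𝓝 (deriv (fun t => ∫ U, F U ∂(μ t)) βW)) := by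
  classical
  -- the DLR state at `β_W` is the unique, translation-invariant one
  have hb' : |βW / 2| ≤ 9 / 50 := by rw [abs_div, abs_two, abs_of_pos hb.1]; linarith [hb.2]
  obtain ⟨ν, hG, hinv⟩ := su2_wilson_oneState_translationInvariant hb'
  have hμβ : μ βW ∈ ymGibbsMeasures (d := 4) (fundamentalRep (Fin 2)) (βW / 2) := by
    have h := hμ βW; rwa [show (2 : ℝ) * (βW / 4) = βW / 2 by ring] at h
  have hμν : μ βW = ν := by rw [hG] at hμβ; exact Set.mem_singleton_iff.1 hμβ
  have hνG : IsGibbsMeasure (ymSpecification (d := 4) (fundamentalRep (Fin 2)) (βW / 2)) (μ βW) := hμβ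
  haveI := hνG.isProbabilityMeasure
  have hinvμ : IsZdTranslationInvariant (μ βW) := by rw [hμν]; exact hinv
  -- ds-1: the static response is absolutely summable and is the derivative
  rcases id hΛ with ⟨x₀, -⟩
  have hD : ∀ e ∈ Λ, ‖e.1 - x₀.1‖ ≤ ((Λ.sup fun e => ⌈‖e.1 - x₀.1‖⌉₊ : ℕ) : ℝ) := fun e he =>
    (Nat.le_ceil _).trans (by exact_mod_cast Finset.le_sup (f := fun e : ZdEdge 4 => ⌈‖e.1 - x₀.1‖⌉₊) he)
  have hb4 : |βW / 4| ≤ 9 / 100 := by rw [abs_div, abs_of_pos hb.1, abs_of_pos (by norm_num : (0:ℝ) < 4)]; linarith [hb.2]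
  have hμ4 : μ βW ∈ ymGibbsMeasures (d := 4) (fundamentalRep (Fin 2)) (2 * (βW / 4)) := hμ βW
  obtain ⟨χ, hχ⟩ := LinearResponseBound.su2_summable_abs_cov_cylinder_plaquette hb4 hμ4 Λ.card
    ((Λ.sup fun e => ⌈‖e.1 - x₀.1‖⌉₊ : ℕ) : ℝ)
  have hsumF : Summable fun r : ZdPlaquette 4 =>
      |cov[F, zdPlaquetteObs (fundamentalRep (Fin 2)) r.1 r.2.1.1 r.2.1.2; μ βW]| :=
    (hχ hF le_rfl hΛ hF1 hD).1
  obtain ⟨hS, hI⟩ := tsum_covariance_energy_shift_eq' (d := 4) (N := 2) (ν := μ βW) hF.measurable hF1 hsumF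
  have hderiv := (CouplingResponse.su2_hasDerivAt_integral_9_25 (fun t _ => hμ t) hF
    (x₀ := x₀.1) (D := Λ.sup fun e => ⌈‖e.1 - x₀.1‖⌉₊) hD hb).deriv
  -- the energy density is bounded and measurable
  have hem : Measurable fun U : LGConfig 4 (Matrix.specialUnitaryGroup (Fin 2) ℂ) =>
      ∑ q : {q : Fin 4 × Fin 4 // q.1 < q.2}, zdPlaquetteObs (fundamentalRep (Fin 2)) 0 q.1.1 q.1.2 U :=
    Finset.measurable_sum _ fun q _ => (isLipschitzCylinder_zdPlaquetteObs (N := 2) 0 q.2).measurable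
  have heb : ∀ U : LGConfig 4 (Matrix.specialUnitaryGroup (Fin 2) ℂ),
      |∑ q : {q : Fin 4 × Fin 4 // q.1 < q.2}, zdPlaquetteObs (fundamentalRep (Fin 2)) 0 q.1.1 q.1.2 U| ≤
        (Finset.univ : Finset {q : Fin 4 × Fin 4 // q.1 < q.2}).card := fun U => by
    refine (Finset.abs_sum_le_sum_abs _ _).trans ?_
    calc ∑ q : {q : Fin 4 × Fin 4 // q.1 < q.2}, |zdPlaquetteObs (fundamentalRep (Fin 2)) 0 q.1.1 q.1.2 U|
        ≤ ∑ _q : {q : Fin 4 × Fin 4 // q.1 < q.2}, (1 : ℝ) :=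
          Finset.sum_le_sum fun q _ => abs_zdPlaquetteObs_le fundamentalRep_mem_unitaryGroup 0 q.1.1 q.1.2 U
      _ = (Finset.univ : Finset {q : Fin 4 × Fin 4 // q.1 < q.2}).card := by simp
  have hlim := tendsto_covariance_boxSum_div hinvμ hF.measurable hF1 hem heb hS
  rw [hderiv, ← hI]
  exact hlim

/-- ★★ **THE PLAQUETTE**: for `0 < β_W < 9/25`, any DLR selection and every plaquette `p = (x; i<j)` of `ℤ⁴`:
`Cov_{μ β_W}(Σ_{y∈B_n} W_p∘θ_y, Σ_{y∈B_n} e∘θ_y)/#B_n → d/dβ_W ⟨W_p⟩_{β_W}` — the derivative of the mean plaquette (ds-1's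
`su2_hasDerivAt_plaquette_9_25`: `= Σ_q Cov(W_p, W_q)`, the plaquette susceptibility) is the covariance density of the plaquette against
the energy. [folklore] -/
theorem su2_plaquette_response_eq_lim_covariance_density
    {μ : ℝ → Measure (LGConfig 4 (Matrix.specialUnitaryGroup (Fin 2) ℂ))}
    (hμ : ∀ βW : ℝ, μ βW ∈ ymGibbsMeasures (d := 4) (fundamentalRep (Fin 2)) (2 * (βW / 4)))
    (x : Site 4) {i j : Fin 4} (hij : i < j) {βW : ℝ} (hb : βW ∈ Ioo (0 : ℝ) (9 / 25)) :
    Tendsto (fun n : ℕ => cov[fun U => ∑ y ∈ siteBox 4 n, zdPlaquetteObs (fundamentalRep (Fin 2)) x i j (configShift y U),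
        fun U => ∑ y ∈ siteBox 4 n, ∑ q : {q : Fin 4 × Fin 4 // q.1 < q.2},
          zdPlaquetteObs (fundamentalRep (Fin 2)) 0 q.1.1 q.1.2 (configShift y U); μ βW] / (siteBox 4 n).card) atTop
      (𝓝 (deriv (fun t => ∫ U, zdPlaquetteObs (fundamentalRep (Fin 2)) x i j U ∂(μ t)) βW)) :=
  su2_response_eq_lim_covariance_density hμ (isLipschitzCylinder_zdPlaquetteObs (N := 2) x hij)
    ⟨(x, i), by simp [plaquetteEdges]⟩ (fun U => abs_zdPlaquetteObs_le fundamentalRep_mem_unitaryGroup x i j U) hb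

/-- ★★ **WILSON LOOPS**: for `0 < β_W < 9/25`, any DLR selection and every closed lattice walk `γ` with at least one link:
`Cov_{μ β_W}(Σ_{y∈B_n} W_γ∘θ_y, Σ_{y∈B_n} e∘θ_y)/#B_n → d/dβ_W ⟨W_γ⟩_{β_W}` (`W_γ = ½ Re tr U_γ`, tree `loopTerm 2 1 γ`) — the β_W-response
of every Wilson loop is its covariance density against the energy. [folklore] -/
theorem su2_loop_response_eq_lim_covariance_density
    {μ : ℝ → Measure (LGConfig 4 (Matrix.specialUnitaryGroup (Fin 2) ℂ))}
    (hμ : ∀ βW : ℝ, μ βW ∈ ymGibbsMeasures (d := 4) (fundamentalRep (Fin 2)) (2 * (βW / 4)))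
    {x : Site 4} (w : (zdGraph 4).Walk x x) (hw : (walkEdges w).Nonempty) {βW : ℝ} (hb : βW ∈ Ioo (0 : ℝ) (9 / 25)) :
    Tendsto (fun n : ℕ => cov[fun U => ∑ y ∈ siteBox 4 n, loopTerm 2 1 w (configShift y U),
        fun U => ∑ y ∈ siteBox 4 n, ∑ q : {q : Fin 4 × Fin 4 // q.1 < q.2},
          zdPlaquetteObs (fundamentalRep (Fin 2)) 0 q.1.1 q.1.2 (configShift y U); μ βW] / (siteBox 4 n).card) atTop
      (𝓝 (deriv (fun t => ∫ U, loopTerm 2 1 w U ∂(μ t)) βW)) :=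
  su2_response_eq_lim_covariance_density hμ (isLipschitzCylinder_loopTerm (N := 2) 1 w) hw
    (fun U => (abs_loopTerm_le (N := 2) (c := 1) w U).trans (by rw [abs_one])) hb

end ResponseFluctuation
end Summit.Ventures.YMGap.RobustBall
end
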